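import Summits.QuantumFields.YangMills.Theorems.UnitScaleTiltProp7DeltaEtaAlmostPositive
import Summits.QuantumFields.YangMills.Theorems.UnitScaleTiltProp7CovariantCurlOfGrad
import Summits.QuantumFields.YangMills.Theorems.UnitScaleTiltProp7RieszTauFrobNormT3
import Summits.QuantumFields.YangMills.Theorems.UnitScaleTiltProp7LandauDictT3
import HarnessLib

/-!
# Route `UnitScaleTilt`, crux «MinimiserStabilityRegPr» (stmt-QuantumFields-19200, stub EX), node N06(d = 3), route (α) — **THE COVARIANT CURL OF A PURE-GAUGE ONE-FORM IS
# THE CURVATURE COMMUTATOR, IN THE HILBERT LETTERS OF THE EX FACE**, and **THE WILSON HESSIAN `Δ^η(U₀)` AGAINST ITS PRINCIPAL PART `‖𝒟·‖²`, TWO-SIDED, ON `𝔘_k(ε₀)`**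
# ([Balaban1985BackgroundPropagators] (3.9)–(3.10): `Δ^η = η⁻²(𝒟*𝒟 + Δ′)`, «Δ′ will be a bounded, small operator»; (3.1)–(3.4): `𝒟D_{U₀}λ = R(U₀(∂p))g − g`)

Cell `ym3-torus` (HUMAN RULING D-0037, YM ladder rung R3 — YM₃ on T³ is a RUNG, NOT d = 4, NOT the Clay problem; the YM mass gap is NOT proved).  Fleet lead seat
`ym-ust-19200-p1` (gen 22), positivity-block lane of the EX face; part 1∕2 of the raw-slot coercivity pen (part 2 = `…Prop7CoerciveRawSlotOfGaugeFixedLift`).  THEOREMS ONLY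
(0 `def`, 0 `sorry`); `--supports stmt-QuantumFields-19200 --as helper`; count-neutral.  Composes ✓`Prop7DeltaEtaAlmostPositive` ∕ ✓`Prop7DeltaPrimeL2Bound` (★w4 g8: the (3.10)
form identity and `|Δ′| ≤ 1029ε₀η²`), ✓`Prop7CovariantCurlOfGrad` (w2-20520 g2: `‖𝒟Dλ(p)‖ ≤ 2‖U₀(∂p) − 1‖‖λ‖`), ✓`Prop7RieszTauFrobNorm` (`|·| ≤ ‖·‖_F ≤ √2|·|` on `M₂(ℂ)`),
✓`Prop7LandauDict.DL2_toL2S_eq_covDerivFwdT`, ✓`Prop7SecondOrderDict` (plaquette clause of `RegPr` in `plaqU` letters).  Nothing of [B9] §3 at a curved background is asserted.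

THE PRINT.  [Balaban1985BackgroundPropagators] p. 392 (3.9)–(3.12): *«⟨A,ΔA⟩ = ⟨A, D*DA⟩ + ⟨A, Δ′A⟩ … Δ′ will be a bounded, small operator, which will be treated as a small
perturbation of D*D»* (`D` = the covariant derivative from bond to plaquette functions); (3.1)–(3.4) pp. 390–391.  [Balaban1985Variational] (14) p. 280 (`|U₀(∂p) − 1| < ε₀η²`).

WHAT IS PROVED (ns `…Theorems.Prop7PureGaugeCurlCurvature`; member `F n K`, fine weight `c₀ > 0`; `P(X) := Σ_{p>0} ‖(𝒟X)(p)‖_F²` written out as the `posPlaq` sum of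
`‖frobEquiv⁻¹(curl (torusT) U₀♭ (formComp X) μ ν x)‖²`).
* §1 `toL2_symm_DL2_toL2S_apply`, `formComp_DL2_toL2S` (the pure-gauge one-form `D_{U₀}(toL2S λ)` in `covD (torusT)` letters, complex scalar `η⁻¹`);
  ★ `normSq_curl_pureGauge_le` — ANY `U₀`, per plaquette: `‖(𝒟 D_{U₀}toL2S λ)(p_{μν}(x))‖_F² ≤ 8η⁻²‖U₀(∂p) − 1‖²·‖λ(x+e_μ+e_ν)‖_F²`.
* §2 ★★ `sum_normSq_curl_pureGauge_le_of_regPr` — `U₀ ∈ 𝔘_k(ε₀)`: `P(D_{U₀}toL2S λ) ≤ 72ε₀²η²·Σ_x‖λ(x)‖_F²` (nine ordered direction pairs, translates re-indexed).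
* §3 ★★ `principal_two_sided_of_regPr` — `U₀ ∈ 𝔘_k(ε₀)`, `0 ≤ ε₀`, any `X`: `c₀η⁻²P(X) − 1029ε₀‖X̃‖² ≤ re⟨X̃, Δ^η(U₀)X̃⟩ ≤ c₀η⁻²P(X) + 1029ε₀‖X̃‖²` (★w4's almost-positivity
  with the principal part KEPT, both sides).
* §4 `curl_formComp_add`, ★ `principal_split` — `P(X) ≤ 2P(X + Y) + 2P(Y)` (the principal part is a sum of squares of a LINEAR map).
HONEST SCOPE.  Lattice bookkeeping; the only estimate of print used is the cited (3.10) bound of ★w4; no positivity ∕ coercivity is claimed here; `hPosΔ`, the other print rows,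
`hThm2S`, EX, the crux are NOT proved; nothing continuum ∕ OS ∕ mass-gap ∕ Clay.

References: T. Bałaban, CMP **99** (1985) 389–434 [Balaban1985BackgroundPropagators] ((3.1)–(3.4) pp.390–391, (3.9)–(3.12) p.392, (3.69) p.404); CMP **102** (1985) 277–309
[Balaban1985Variational] ((2) p.278, (14) p.280); CMP **98** (1985) 17–51 [Balaban1985Averaging] ((18)–(20) p.21).
-/

set_option autoImplicit false

noncomputable section

open scoped InnerProductSpace ComplexConjugate Matrix.Norms.L2Operator BigOperators

namespace Summit.QuantumFields.YangMills.Theorems.Prop7PureGaugeCurlCurvature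

open Literature.MathematicalPhysics.QuantumFieldTheory.Balaban1983to89
open Literature.MathematicalPhysics.QuantumFieldTheory.Balaban1983to89.T3ContinuumYM3Torus
open Literature.MathematicalPhysics.QuantumFieldTheory.Balaban1983to89.T3PrintedRegularMinimiser (RegPr)
open Literature.MathematicalPhysics.QuantumFieldTheory.Balaban1983to89.T3RegularMinimiser (regThreshold)
open T4Continuum BlockAveraging
open T3SectALandauChart (formComp bgUnits covCodiffCurlT covDerivFwdT eta eta_pos)
open B9TorusCalculus (torusT torusT_comm)
open B9Eq39Adjoint (R covD curl plaqU posPlaq curl_smul covD_add)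
open B9Eq310Hermitian (deltaPrimeOp)
open B11Eq103H1Complex (SiteL2K BondL2K)
open Summit.QuantumFields.YangMills.Theorems.Prop7SectET3Transport (periodsT3)
open Summit.QuantumFields.YangMills.Theorems.Prop7SectET3HilbertLetters (W₂ frobEquiv frobEquiv_symm_apply_apply toL2 toL2S DL2 DstarL2 covLapSite)
open Summit.QuantumFields.YangMills.Theorems.Prop7SecondOrderDict (val_plaqU_torusT_eq_plaqFT norm_bgUnits_le_one norm_plaqFT_bgUnits_sub_one_le covDerivFwdT_eq_smul_covD)
open Summit.QuantumFields.YangMills.Theorems.Prop7LandauDict (DL2_toL2S_eq_covDerivFwdT)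
open Summit.QuantumFields.YangMills.Theorems.Prop7CovariantCurlOfGrad (norm_curl_covD_le)
open Summit.QuantumFields.YangMills.Theorems.Prop7RieszTauFrobNorm (norm_sq_frobEquiv_symm norm_le_norm_frobEquiv_symm sum_norm_sq_le_two_mul_opNorm_sq)

variable {F : T3Family} {n K : ℕ} {c₀ : ℝ}

/-! ## §1 The covariant curl of a pure-gauge one-form at a printed-regular background, plaquette by plaquette -/

/-- **THE PURE-GAUGE ONE-FORM `D_{U₀}λ` ON THE ROUTE CARRIER**: `(toL2)⁻¹(D_{U₀}(toL2S λ))(b) = η⁻¹ • (D_{U₀,b}λ)` in the `covD (torusT)` letters of `B9Eq39Adjoint`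
(complex scalar). [cite: Balaban1985BackgroundPropagators, (3.3) p.391] -/
theorem toL2_symm_DL2_toL2S_apply [Fact (0 < c₀)] (U₀ : GaugeField (F.P K) 0 (Matrix.specialUnitaryGroup (Fin 2) ℂ))
    (lam : Site (F.P K) 0 → Matrix (Fin 2) (Fin 2) ℂ) (b : PBond (F.P K) 0) :
    (toL2 F K c₀).symm (DL2 F n K c₀ U₀ (toL2S F K c₀ lam)) b
      = (((eta F n K)⁻¹ : ℝ) : ℂ) • covD (torusT (F.P K) 0) (fun μ z => bgUnits F K U₀ ⟨z, μ⟩) b.dir lam b.src := by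
  rw [DL2_toL2S_eq_covDerivFwdT, covDerivFwdT_eq_smul_covD, Complex.coe_smul]

/-- The one-form components of `D_{U₀}λ`: `formComp ((toL2)⁻¹(D_{U₀} toL2S λ)) = η⁻¹ • (κ ↦ D_{U₀,κ}λ)`. [cite: Balaban1985BackgroundPropagators, (3.3) p.391] -/
theorem formComp_DL2_toL2S [Fact (0 < c₀)] (U₀ : GaugeField (F.P K) 0 (Matrix.specialUnitaryGroup (Fin 2) ℂ))
    (lam : Site (F.P K) 0 → Matrix (Fin 2) (Fin 2) ℂ) :
    formComp ((toL2 F K c₀).symm (DL2 F n K c₀ U₀ (toL2S F K c₀ lam)))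
      = (((eta F n K)⁻¹ : ℝ) : ℂ) • fun κ => covD (torusT (F.P K) 0) (fun μ z => bgUnits F K U₀ ⟨z, μ⟩) κ lam := by
  funext κ x
  show (toL2 F K c₀).symm (DL2 F n K c₀ U₀ (toL2S F K c₀ lam)) ⟨x, κ⟩ = _
  rw [toL2_symm_DL2_toL2S_apply]
  rfl

/-- ★ **THE CURL OF A PURE-GAUGE ONE-FORM IS THE CURVATURE COMMUTATOR, IN NORM** (Frobenius reading on the Hilbert fibre): at ANY background, on the plaquette `p_{μν}(x)`,
`‖(𝒟(η⁻¹D_{U₀}λ))(p)‖_F² ≤ 8·η⁻²·‖U₀(∂p) − 1‖²·‖λ(x+e_μ+e_ν)‖_F²` (✓`Prop7CovariantCurlOfGrad.norm_curl_covD_le` `‖𝒟Dλ(p)‖ ≤ 2‖U₀(∂p) − 1‖·‖λ(·)‖` in operator norm,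
and `|·| ≤ ‖·‖_F ≤ √2|·|` on `M₂(ℂ)`). [cite: Balaban1985BackgroundPropagators, (3.1)–(3.4) pp.390–391, (3.9) p.392] -/
theorem normSq_curl_pureGauge_le [Fact (0 < c₀)] (U₀ : GaugeField (F.P K) 0 (Matrix.specialUnitaryGroup (Fin 2) ℂ))
    (lam : Site (F.P K) 0 → Matrix (Fin 2) (Fin 2) ℂ) (μ ν : Fin (F.P K).d) (x : Site (F.P K) 0) :
    ‖(frobEquiv.symm (curl (torusT (F.P K) 0) (fun μ z => bgUnits F K U₀ ⟨z, μ⟩)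
        (formComp ((toL2 F K c₀).symm (DL2 F n K c₀ U₀ (toL2S F K c₀ lam)))) μ ν x) : W₂)‖ ^ 2
      ≤ 8 * (eta F n K)⁻¹ ^ 2 * ‖(plaqU (torusT (F.P K) 0) (fun μ z => bgUnits F K U₀ ⟨z, μ⟩) μ ν x : Matrix (Fin 2) (Fin 2) ℂ) - 1‖ ^ 2
          * ‖(frobEquiv.symm (lam (torusT (F.P K) 0 μ (torusT (F.P K) 0 ν x))) : W₂)‖ ^ 2 := by
  set T := torusT (F.P K) 0 with hT
  set U : Fin (F.P K).d → Site (F.P K) 0 → (Matrix (Fin 2) (Fin 2) ℂ)ˣ := fun μ z => bgUnits F K U₀ ⟨z, μ⟩ with hU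
  have hη : 0 < eta F n K := eta_pos F n K
  have hUn : ∀ (κ : Fin (F.P K).d) (y : Site (F.P K) 0), ‖(U κ y : Matrix (Fin 2) (Fin 2) ℂ)‖ ≤ 1 ∧ ‖(((U κ y)⁻¹ : (Matrix (Fin 2) (Fin 2) ℂ)ˣ) : Matrix (Fin 2) (Fin 2) ℂ)‖ ≤ 1 :=
    fun κ y => norm_bgUnits_le_one F K U₀ ⟨y, κ⟩
  -- the curl of the pure-gauge form is `η⁻¹ •` the curl of `κ ↦ D_κλ`
  have hcurl : curl T U (formComp ((toL2 F K c₀).symm (DL2 F n K c₀ U₀ (toL2S F K c₀ lam)))) μ ν x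
      = (((eta F n K)⁻¹ : ℝ) : ℂ) • curl T U (fun κ => covD T U κ lam) μ ν x := by
    rw [formComp_DL2_toL2S, curl_smul]
  -- operator-norm bound of the curvature commutator
  have hop : ‖curl T U (fun κ => covD T U κ lam) μ ν x‖ ≤ 2 * ‖(plaqU T U μ ν x : Matrix (Fin 2) (Fin 2) ℂ) - 1‖ * ‖lam (T μ (T ν x))‖ :=
    norm_curl_covD_le T U hUn lam μ ν x (by rw [hT, torusT_comm])
  have hop0 : 0 ≤ 2 * ‖(plaqU T U μ ν x : Matrix (Fin 2) (Fin 2) ℂ) - 1‖ * ‖lam (T μ (T ν x))‖ := by positivity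
  -- Frobenius ≤ √2 · operator, operator ≤ Frobenius
  have h1 : ‖(frobEquiv.symm (curl T U (fun κ => covD T U κ lam) μ ν x) : W₂)‖ ^ 2
      ≤ 2 * (2 * ‖(plaqU T U μ ν x : Matrix (Fin 2) (Fin 2) ℂ) - 1‖ * ‖lam (T μ (T ν x))‖) ^ 2 := by
    rw [norm_sq_frobEquiv_symm]
    refine (sum_norm_sq_le_two_mul_opNorm_sq _).trans ?_
    exact mul_le_mul_of_nonneg_left (pow_le_pow_left₀ (norm_nonneg _) hop 2) (by norm_num)
  have h2 : ‖lam (T μ (T ν x))‖ ≤ ‖(frobEquiv.symm (lam (T μ (T ν x))) : W₂)‖ := norm_le_norm_frobEquiv_symm _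
  rw [hcurl, map_smul, norm_smul, mul_pow, Complex.norm_real, Real.norm_of_nonneg (inv_nonneg.2 hη.le)]
  have h3 : (2 * ‖(plaqU T U μ ν x : Matrix (Fin 2) (Fin 2) ℂ) - 1‖ * ‖lam (T μ (T ν x))‖) ^ 2
      ≤ 4 * ‖(plaqU T U μ ν x : Matrix (Fin 2) (Fin 2) ℂ) - 1‖ ^ 2 * ‖(frobEquiv.symm (lam (T μ (T ν x))) : W₂)‖ ^ 2 := by
    rw [mul_pow, mul_pow]
    have := pow_le_pow_left₀ (norm_nonneg _) h2 2
    nlinarith [sq_nonneg ‖(plaqU T U μ ν x : Matrix (Fin 2) (Fin 2) ℂ) - 1‖]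
  calc (eta F n K)⁻¹ ^ 2 * ‖(frobEquiv.symm (curl T U (fun κ => covD T U κ lam) μ ν x) : W₂)‖ ^ 2
      ≤ (eta F n K)⁻¹ ^ 2 * (2 * (2 * ‖(plaqU T U μ ν x : Matrix (Fin 2) (Fin 2) ℂ) - 1‖ * ‖lam (T μ (T ν x))‖) ^ 2) :=
        mul_le_mul_of_nonneg_left h1 (by positivity)
    _ ≤ (eta F n K)⁻¹ ^ 2 * (2 * (4 * ‖(plaqU T U μ ν x : Matrix (Fin 2) (Fin 2) ℂ) - 1‖ ^ 2 * ‖(frobEquiv.symm (lam (T μ (T ν x))) : W₂)‖ ^ 2)) :=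
        mul_le_mul_of_nonneg_left (mul_le_mul_of_nonneg_left h3 (by norm_num)) (by positivity)
    _ = _ := by ring

/-- ★★ **ON THE PRINTED-REGULAR CLASS THE PRINCIPAL (`𝒟*𝒟`) PART OF `Δ^η` IS CURVATURE-SMALL ON PURE-GAUGE ONE-FORMS** — summed over the positively oriented plaquettes:
`Σ_{p} ‖(𝒟(η⁻¹D_{U₀}λ))(p)‖_F² ≤ 72·ε₀²·η²·Σ_x ‖λ(x)‖_F²` for `U₀ ∈ 𝔘_k(ε₀)` (`‖U₀(∂p) − 1‖ ≤ ε₀η²` on every plaquette, `d = 3`: the nine ordered direction pairs each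
contribute a translate of `Σ_x‖λ(x)‖²`). [cite: Balaban1985BackgroundPropagators, (3.9)–(3.10) p.392; Balaban1985Variational, (2) p.278, (14) p.280] -/
theorem sum_normSq_curl_pureGauge_le_of_regPr [Fact (0 < c₀)] {ε₀ : ℝ} (U₀ : GaugeField (F.P K) 0 (Matrix.specialUnitaryGroup (Fin 2) ℂ))
    (hreg : RegPr F n K ε₀ U₀) (lam : Site (F.P K) 0 → Matrix (Fin 2) (Fin 2) ℂ) :
    ∑ q ∈ posPlaq (Site (F.P K) 0) (Fin (F.P K).d),
        ‖(frobEquiv.symm (curl (torusT (F.P K) 0) (fun μ z => bgUnits F K U₀ ⟨z, μ⟩)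
          (formComp ((toL2 F K c₀).symm (DL2 F n K c₀ U₀ (toL2S F K c₀ lam)))) q.2.1 q.2.2 q.1) : W₂)‖ ^ 2
      ≤ 72 * ε₀ ^ 2 * eta F n K ^ 2 * ∑ x : Site (F.P K) 0, ‖(frobEquiv.symm (lam x) : W₂)‖ ^ 2 := by
  set T := torusT (F.P K) 0 with hT
  set U : Fin (F.P K).d → Site (F.P K) 0 → (Matrix (Fin 2) (Fin 2) ℂ)ˣ := fun μ z => bgUnits F K U₀ ⟨z, μ⟩ with hU
  have hη : 0 < eta F n K := eta_pos F n K
  -- the plaquette clause of `RegPr` in `plaqU` letters: `‖U₀(∂p) − 1‖ ≤ ε₀η²` for `μ ≠ ν`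
  have hδ : regThreshold F n K ε₀ = ε₀ * eta F n K ^ 2 := by
    rw [regThreshold, eta, ← pow_mul, mul_comm 2 (K - n)]
  have hW : ∀ (μ ν : Fin (F.P K).d) (y : Site (F.P K) 0), μ ≠ ν → ‖(plaqU T U μ ν y : Matrix (Fin 2) (Fin 2) ℂ) - 1‖ ≤ ε₀ * eta F n K ^ 2 := by
    intro μ ν y hμν
    rw [hT, hU, val_plaqU_torusT_eq_plaqFT, ← hδ]
    exact norm_plaqFT_bgUnits_sub_one_le F K U₀ hreg.plaqSmall μ ν y hμν
  -- per plaquette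
  have hterm : ∀ q ∈ posPlaq (Site (F.P K) 0) (Fin (F.P K).d),
      ‖(frobEquiv.symm (curl T U (formComp ((toL2 F K c₀).symm (DL2 F n K c₀ U₀ (toL2S F K c₀ lam)))) q.2.1 q.2.2 q.1) : W₂)‖ ^ 2
        ≤ 8 * ε₀ ^ 2 * eta F n K ^ 2 * ‖(frobEquiv.symm (lam (T q.2.1 (T q.2.2 q.1))) : W₂)‖ ^ 2 := by
    intro q hq
    have hμν : q.2.1 ≠ q.2.2 := (Finset.mem_filter.1 hq).2.ne
    refine (normSq_curl_pureGauge_le (c₀ := c₀) U₀ lam q.2.1 q.2.2 q.1).trans ?_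
    have hp := hW q.2.1 q.2.2 q.1 hμν
    have hp0 : 0 ≤ ‖(plaqU T U q.2.1 q.2.2 q.1 : Matrix (Fin 2) (Fin 2) ℂ) - 1‖ := norm_nonneg _
    have hp2 : ‖(plaqU T U q.2.1 q.2.2 q.1 : Matrix (Fin 2) (Fin 2) ℂ) - 1‖ ^ 2 ≤ (ε₀ * eta F n K ^ 2) ^ 2 := pow_le_pow_left₀ hp0 hp 2
    have hηinv : (eta F n K)⁻¹ ^ 2 * (ε₀ * eta F n K ^ 2) ^ 2 = ε₀ ^ 2 * eta F n K ^ 2 := by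
      field_simp
    calc 8 * (eta F n K)⁻¹ ^ 2 * ‖(plaqU T U q.2.1 q.2.2 q.1 : Matrix (Fin 2) (Fin 2) ℂ) - 1‖ ^ 2 * ‖(frobEquiv.symm (lam (T q.2.1 (T q.2.2 q.1))) : W₂)‖ ^ 2
        ≤ 8 * (eta F n K)⁻¹ ^ 2 * (ε₀ * eta F n K ^ 2) ^ 2 * ‖(frobEquiv.symm (lam (T q.2.1 (T q.2.2 q.1))) : W₂)‖ ^ 2 := by
          gcongr
    _ = 8 * ε₀ ^ 2 * eta F n K ^ 2 * ‖(frobEquiv.symm (lam (T q.2.1 (T q.2.2 q.1))) : W₂)‖ ^ 2 := by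
          rw [show (8 : ℝ) * (eta F n K)⁻¹ ^ 2 * (ε₀ * eta F n K ^ 2) ^ 2 = 8 * ((eta F n K)⁻¹ ^ 2 * (ε₀ * eta F n K ^ 2) ^ 2) by ring, hηinv]
          ring
  -- sum: enlarge `posPlaq` to all `(x, μ, ν)` and re-index the translates
  have hsub : ∑ q ∈ posPlaq (Site (F.P K) 0) (Fin (F.P K).d), 8 * ε₀ ^ 2 * eta F n K ^ 2 * ‖(frobEquiv.symm (lam (T q.2.1 (T q.2.2 q.1))) : W₂)‖ ^ 2
      ≤ ∑ q : Site (F.P K) 0 × Fin (F.P K).d × Fin (F.P K).d, 8 * ε₀ ^ 2 * eta F n K ^ 2 * ‖(frobEquiv.symm (lam (T q.2.1 (T q.2.2 q.1))) : W₂)‖ ^ 2 :=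
    Finset.sum_le_univ_sum_of_nonneg fun q => by positivity
  have hall : ∑ q : Site (F.P K) 0 × Fin (F.P K).d × Fin (F.P K).d, 8 * ε₀ ^ 2 * eta F n K ^ 2 * ‖(frobEquiv.symm (lam (T q.2.1 (T q.2.2 q.1))) : W₂)‖ ^ 2
      = 72 * ε₀ ^ 2 * eta F n K ^ 2 * ∑ x : Site (F.P K) 0, ‖(frobEquiv.symm (lam x) : W₂)‖ ^ 2 := by
    rw [Fintype.sum_prod_type, Finset.sum_comm]
    simp only [Fintype.sum_prod_type]
    have hre : ∀ μ ν : Fin (F.P K).d, ∑ x : Site (F.P K) 0, 8 * ε₀ ^ 2 * eta F n K ^ 2 * ‖(frobEquiv.symm (lam (T μ (T ν x))) : W₂)‖ ^ 2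
        = 8 * ε₀ ^ 2 * eta F n K ^ 2 * ∑ x : Site (F.P K) 0, ‖(frobEquiv.symm (lam x) : W₂)‖ ^ 2 := by
      intro μ ν
      rw [← Finset.mul_sum]
      congr 1
      exact Fintype.sum_equiv ((T ν).trans (T μ)) _ _ fun x => rfl
    simp only [hre, Finset.sum_const, Finset.card_univ, Fintype.card_fin]
    norm_num [T3Family.P_d]
    ring
  exact (Finset.sum_le_sum hterm).trans (hsub.trans hall.le)


/-! ## §3 The form of `Δ^η(U₀)` against its principal (`𝒟*𝒟`) part: two-sided, on the printed-regular class -/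

open Summit.QuantumFields.YangMills.Theorems.Prop7SectET3WilsonHessian (DeltaEta DeltaEtaSlot DeltaEtaSlot_apply)
open Summit.QuantumFields.YangMills.Theorems.Prop7DeltaEtaAlmostPositive (re_inner_DeltaEta_toL2_eq sum_trace_conjTranspose_mul_covCodiffCurlT_eq_sum_sq norm_toL2_sq)
open Summit.QuantumFields.YangMills.Theorems.Prop7DeltaPrimeL2Bound (norm_sum_trace_conjTranspose_mul_deltaPrimeOp_le)

/-- ★★ **(3.10) TWO-SIDED ON `𝔘_k(ε₀)`: `re⟪X̃, Δ^η(U₀)X̃⟫` IS ITS PRINCIPAL PART `c₀η⁻²·Σ_p ‖(𝒟X)(p)‖_F²` UP TO `±1029ε₀‖X̃‖²`** (`Δ^η = η⁻²(𝒟*𝒟 + Δ′)`, «Δ′ will be a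
bounded, small operator» p. 392; ✓`re_inner_DeltaEta_toL2_eq`, ✓`sum_trace_conjTranspose_mul_covCodiffCurlT_eq_sum_sq`, ✓`norm_sum_trace_conjTranspose_mul_deltaPrimeOp_le`).
[cite: Balaban1985BackgroundPropagators, (3.9)–(3.12) p.392, (3.69) p.404; Balaban1985Variational, (14) p.280] -/
theorem principal_two_sided_of_regPr [Fact (0 < c₀)] {ε₀ : ℝ} (hε₀ : 0 ≤ ε₀) (U₀ : GaugeField (F.P K) 0 (Matrix.specialUnitaryGroup (Fin 2) ℂ))
    (hreg : RegPr F n K ε₀ U₀) (X : PBond (F.P K) 0 → Matrix (Fin 2) (Fin 2) ℂ) :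
    c₀ * (eta F n K)⁻¹ ^ 2 * (∑ q ∈ posPlaq (Site (F.P K) 0) (Fin (F.P K).d),
        ‖(frobEquiv.symm (curl (torusT (F.P K) 0) (fun μ z => bgUnits F K U₀ ⟨z, μ⟩) (formComp X) q.2.1 q.2.2 q.1) : W₂)‖ ^ 2)
        - 1029 * ε₀ * ‖toL2 F K c₀ X‖ ^ 2
      ≤ RCLike.re ⟪toL2 F K c₀ X, DeltaEta F n K c₀ U₀ (toL2 F K c₀ X)⟫_ℂ ∧
    RCLike.re ⟪toL2 F K c₀ X, DeltaEta F n K c₀ U₀ (toL2 F K c₀ X)⟫_ℂ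
      ≤ c₀ * (eta F n K)⁻¹ ^ 2 * (∑ q ∈ posPlaq (Site (F.P K) 0) (Fin (F.P K).d),
        ‖(frobEquiv.symm (curl (torusT (F.P K) 0) (fun μ z => bgUnits F K U₀ ⟨z, μ⟩) (formComp X) q.2.1 q.2.2 q.1) : W₂)‖ ^ 2)
        + 1029 * ε₀ * ‖toL2 F K c₀ X‖ ^ 2 := by
  have hc₀ : 0 < c₀ := Fact.out
  have hη : 0 < eta F n K := eta_pos F n K
  rw [re_inner_DeltaEta_toL2_eq, sum_trace_conjTranspose_mul_covCodiffCurlT_eq_sum_sq, Complex.ofReal_re, norm_toL2_sq]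
  set SF : ℝ := ∑ b : PBond (F.P K) 0, ‖(frobEquiv.symm (X b) : W₂)‖ ^ 2 with hSF
  set SP : ℝ := ∑ q ∈ posPlaq (Site (F.P K) 0) (Fin (F.P K).d),
        ‖(frobEquiv.symm (curl (torusT (F.P K) 0) (fun μ z => bgUnits F K U₀ ⟨z, μ⟩) (formComp X) q.2.1 q.2.2 q.1) : W₂)‖ ^ 2 with hSP
  set E : ℝ := (∑ b : PBond (F.P K) 0, Matrix.trace ((X b).conjTranspose
          * deltaPrimeOp (torusT (F.P K) 0) (fun μ x => bgUnits F K U₀ ⟨x, μ⟩) 1 (formComp X) b.dir b.src)).re with hE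
  have hD := norm_sum_trace_conjTranspose_mul_deltaPrimeOp_le hε₀ U₀ hreg X
  have hEabs : |E| ≤ 1029 * (ε₀ * eta F n K ^ 2) * SF :=
    (Complex.abs_re_le_norm _).trans hD
  have hE1 := (abs_le.1 hEabs).1
  have hE2 := (abs_le.1 hEabs).2
  have hk : 0 ≤ c₀ * (eta F n K)⁻¹ ^ 2 := by positivity
  have hkey : c₀ * (eta F n K)⁻¹ ^ 2 * (1029 * (ε₀ * eta F n K ^ 2) * SF) = 1029 * ε₀ * (c₀ * SF) := by
    field_simp
  constructor
  · have h1 : c₀ * (eta F n K)⁻¹ ^ 2 * (SP + -(1029 * (ε₀ * eta F n K ^ 2) * SF)) ≤ c₀ * (eta F n K)⁻¹ ^ 2 * (SP + E) :=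
      mul_le_mul_of_nonneg_left (by linarith) hk
    calc c₀ * (eta F n K)⁻¹ ^ 2 * SP - 1029 * ε₀ * (c₀ * SF) = c₀ * (eta F n K)⁻¹ ^ 2 * (SP + -(1029 * (ε₀ * eta F n K ^ 2) * SF)) := by
          rw [mul_add, mul_neg, hkey]; ring
      _ ≤ _ := h1
  · have h1 : c₀ * (eta F n K)⁻¹ ^ 2 * (SP + E) ≤ c₀ * (eta F n K)⁻¹ ^ 2 * (SP + 1029 * (ε₀ * eta F n K ^ 2) * SF) :=
      mul_le_mul_of_nonneg_left (by linarith) hk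
    calc _ ≤ _ := h1
      _ = c₀ * (eta F n K)⁻¹ ^ 2 * SP + 1029 * ε₀ * (c₀ * SF) := by rw [mul_add, hkey]

/-! ## §4 The principal part is a sum of squares of a LINEAR map: the split `P(A) ≤ 2P(A + G) + 2P(G)` -/

/-- The covariant curl is additive in the one-form (its two covariant differences are). [folklore] [cite: Balaban1985BackgroundPropagators, (3.9) p.392] -/
theorem curl_formComp_add (U₀ : GaugeField (F.P K) 0 (Matrix.specialUnitaryGroup (Fin 2) ℂ)) (X Y : PBond (F.P K) 0 → Matrix (Fin 2) (Fin 2) ℂ)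
    (μ ν : Fin (F.P K).d) (x : Site (F.P K) 0) :
    curl (torusT (F.P K) 0) (fun μ z => bgUnits F K U₀ ⟨z, μ⟩) (formComp (X + Y)) μ ν x
      = curl (torusT (F.P K) 0) (fun μ z => bgUnits F K U₀ ⟨z, μ⟩) (formComp X) μ ν x
        + curl (torusT (F.P K) 0) (fun μ z => bgUnits F K U₀ ⟨z, μ⟩) (formComp Y) μ ν x := by
  have hX : ∀ κ, formComp (X + Y) κ = formComp X κ + formComp Y κ := fun κ => by funext z; rfl
  show covD _ _ μ (formComp (X + Y) ν) x - covD _ _ ν (formComp (X + Y) μ) x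
    = (covD _ _ μ (formComp X ν) x - covD _ _ ν (formComp X μ) x) + (covD _ _ μ (formComp Y ν) x - covD _ _ ν (formComp Y μ) x)
  rw [hX, hX, covD_add, covD_add]
  abel

/-- ★ **THE PRINCIPAL PART SPLITS**: `Σ_p‖𝒟A(p)‖² ≤ 2·Σ_p‖𝒟(A + G)(p)‖² + 2·Σ_p‖𝒟G(p)‖²` (per plaquette `‖u − w‖² ≤ 2‖u‖² + 2‖w‖²` for `u = 𝒟(A+G)(p)`, `w = 𝒟G(p)`).
[cite: Balaban1985BackgroundPropagators, (3.9)–(3.10) p.392] -/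
theorem principal_split (U₀ : GaugeField (F.P K) 0 (Matrix.specialUnitaryGroup (Fin 2) ℂ)) (X Y : PBond (F.P K) 0 → Matrix (Fin 2) (Fin 2) ℂ) :
    ∑ q ∈ posPlaq (Site (F.P K) 0) (Fin (F.P K).d),
        ‖(frobEquiv.symm (curl (torusT (F.P K) 0) (fun μ z => bgUnits F K U₀ ⟨z, μ⟩) (formComp X) q.2.1 q.2.2 q.1) : W₂)‖ ^ 2
      ≤ 2 * ∑ q ∈ posPlaq (Site (F.P K) 0) (Fin (F.P K).d),
          ‖(frobEquiv.symm (curl (torusT (F.P K) 0) (fun μ z => bgUnits F K U₀ ⟨z, μ⟩) (formComp (X + Y)) q.2.1 q.2.2 q.1) : W₂)‖ ^ 2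
        + 2 * ∑ q ∈ posPlaq (Site (F.P K) 0) (Fin (F.P K).d),
          ‖(frobEquiv.symm (curl (torusT (F.P K) 0) (fun μ z => bgUnits F K U₀ ⟨z, μ⟩) (formComp Y) q.2.1 q.2.2 q.1) : W₂)‖ ^ 2 := by
  rw [Finset.mul_sum, Finset.mul_sum, ← Finset.sum_add_distrib]
  refine Finset.sum_le_sum fun q _ => ?_
  set u : W₂ := frobEquiv.symm (curl (torusT (F.P K) 0) (fun μ z => bgUnits F K U₀ ⟨z, μ⟩) (formComp (X + Y)) q.2.1 q.2.2 q.1) with hu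
  set w : W₂ := frobEquiv.symm (curl (torusT (F.P K) 0) (fun μ z => bgUnits F K U₀ ⟨z, μ⟩) (formComp Y) q.2.1 q.2.2 q.1) with hw
  have hv : (frobEquiv.symm (curl (torusT (F.P K) 0) (fun μ z => bgUnits F K U₀ ⟨z, μ⟩) (formComp X) q.2.1 q.2.2 q.1) : W₂) = u - w := by
    rw [hu, hw, ← map_sub, curl_formComp_add, add_sub_cancel_right]
  rw [hv]
  have h := norm_sub_le u w
  nlinarith [norm_nonneg u, norm_nonneg w, norm_nonneg (u - w), sq_nonneg (‖u‖ - ‖w‖)]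

end Summit.QuantumFields.YangMills.Theorems.Prop7PureGaugeCurlCurvature

end
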